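import Summits.BirchSwinnertonDyer.BirchSwinnertonDyer.Theorems.ByReductionTypeAtTwoAdditivePotGoodPrintKrizLi92b1Base
import Literature.NumberTheory.EllipticCurves.BurungaleSkinner2023.X011TwistsCertificateProofs
import Literature.NumberTheory.EllipticCurves.OrdinaryPrimesProofs
import Literature.NumberTheory.EllipticCurves.LeadingTermTamagawaProofs
import Mathlib.Tactic.NormNum.LegendreSymbol
import HarnessLib

/-!
# Route `GenusKolyvaginAtTwo`, crux U₂ `MinimalTwinBSDTwo` (stmt-BirchSwinnertonDyer-22985), LINE 23 «twin_swap»: KERNEL data of the Kriz–Li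
# RANK-ZERO ANCHOR `11a1 = X₀(11) = [0,−1,1,−10,−20]` (the tree's `X1Eleven.curve11A1`; Cremona Table 1 «11 A1»: `N = 11`, `r = 0`, `Δ = −11⁵`, split
# multiplicative at `11`, GOOD at `2`; Kriz–Li §6 TABLE 2 row `11a1 | −7 | 1 | ✓`) over `K = ℚ(√−7)` — `E[2]` irreducible (the `2`-division cubic
# `X³ − 4X² − 160X − 1264` has no root mod `3`), good reduction at `2` with `c₂ = 1`, non-CM, `N = 11`, `r_an = 0` (tree, mod modularity); the partner
# `11a1^{(−7)} = [0,7,1,−490,6774]` (`I₀*` at `7`, `I₅` at `11`: `N = 7²·11 = 539 < 5000`); the packet witness `ℓ = 23` (`#Ẽ(𝔽₂₃) = 25`, `a₂₃ = −1` odd)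

Seat `bsd-line-gk2-p2` g35 (PROVER 2/3, cell `bsd-f1-sign2`; LINE 23 holder), `--supports stmt-BirchSwinnertonDyer-22985` (helper; closes nothing).
KERNEL THEOREMS ONLY (0 `def`, 0 `sorry`); standard axioms; the one print binder is the Modularity Theorem (`exists_isNewformOf`) inside the tree's
`Curve11a.analyticRank_eq_zero_of_modularity` (re-exported here as `analyticRank_11A1`).  Companion of `…KrizLiAnchor37a1Base/43a1Base.lean` (this
seat's lineage, g34: the RANK-ONE Table-1 anchors with `d_K²·N < 5000`) and of the K4 seat's `…PrintKrizLi44a1Base/92a1Base.lean` (cell `bsd-2adic`: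
the two ADDITIVE rank-zero Table-2 anchors).  NEW HERE: the rank-ZERO anchors of Kriz–Li's Table 2 that are GOOD at `2` with `c₂` odd and
`49·N < 5000` — `11a1`, `37b1`, `67a1` — matter for U₂ because the RANK-ONE HALF of their packets, the curves `E^{(−7d)}` (`d ∈ 𝒩(E, ℚ(√−7))`,
`χ_d(−N) = 1`), consists of non-CM curves of analytic rank one (U₂'s class) whose `BSD₂` follows from PRINT ALONE: both numerical inputs of
Kriz–Li Thm 5.1 (2) — `BSD(E, 2)` and `BSD(E^{(−7)}, 2)` — lie in Creutz–Miller's range (`N`, `49·N < 5000`), so NO rank-zero wall row and NO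
LINE 23 research stub is used (road file `…KrizLiAnchor11a1.lean`).  This file: the anchor's kernel data (reusing the tree's `X1Eleven` /
`BurungaleSkinner2023` / `Curve11a` theorems on `curve11A1`: ellipticity, global minimality, good reduction away from `11`, multiplicative at `11`,
`N = 11`, `r_an = 0`), the partner's model and conductor (Tate certificate at `7`: the b2b engine `DeepCert`, exit `6` = `I₀*`, translation
`t = 24`), and the packet witness.  Closes nothing; nothing booked; **BSD is NOT proved by any of this; U₂ is NOT proved.**

References: [KrizLi2019] Thm 5.1 (2), Def 4.1, §6 Example 6.5 and Table 2 (row 11a1, arXiv:1606.03172v3 Congruence.tex l. 1043), Example 6.4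
(`E = 11a1`: "Since BSD(2) is true for `E/ℚ` and `E^{(−7)}/ℚ` by numerical verification, it follows from Theorem 5.1 that the BSD(2) is true for
`E^{(d)}` and `E^{(−7d)}`"); [CremonaAlgorithms1997] Table 1 (11A1; 539); [SilvermanAEC2009] III.2.3, VII.1, VII.5, X.5, App. C §11; [Silverman1994]
IV.9.4, IV.11.1; [Kraus1989] Prop. 1–2.
-/

set_option autoImplicit false
-- the Theorems namespace of this sub repeats the summit name by design (D-0017 nested layout)
set_option linter.dupNamespace false

noncomputable section

open scoped Classical NumberField

open WeierstrassCurve IsDedekindDomain Rat.HeightOneSpectrum Literature.NumberTheory.EllipticCurves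
  Literature.NumberTheory.EllipticCurves.ModularForms
  Literature.NumberTheory.EllipticCurves.Rank1Residual
  Literature.NumberTheory.EllipticCurves.X1Eleven
  Literature.NumberTheory.EllipticCurves.BurungaleSkinner2023
  Literature.NumberTheory.DiophantineGeometry
  Summit.BirchSwinnertonDyer
  Summit.BirchSwinnertonDyer.Rank1Residual
  Summit.BirchSwinnertonDyer.Rank1Residual.X11b
  Summit.BirchSwinnertonDyer.Rank1Residual.X5.O1
  Summit.BirchSwinnertonDyer.Rank1Residual.P2
  Summit.BirchSwinnertonDyer.BirchSwinnertonDyer.Rank1Residual.IntModel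
  Summit.BirchSwinnertonDyer.BirchSwinnertonDyer.Theorems
  Summit.BirchSwinnertonDyer.BirchSwinnertonDyer.Theorems.AddPotGoodPrint
  Summit.BirchSwinnertonDyer.BirchSwinnertonDyer.Rank2Observatory.Tate

namespace Summit.BirchSwinnertonDyer.BirchSwinnertonDyer.Theorems.GenusExact.TwinSwap.KrizLiAnchor11a1

/-! ## §1 The anchor `11a1 = curve11A1 = [0, −1, 1, −10, −20]`: `Δ = −11⁵`, `c₄ = 496`, GOOD at `2`, split `I₅` at `11`, `r_an = 0` -/
section Base11A1

/-- The tree's `X1Eleven.curve11A1` IS the literal model `[0, −1, 1, −10, −20]`. [cite: CremonaAlgorithms1997, Table 1 (11A1)] -/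
theorem curve11A1_eq : curve11A1 = (⟨0, -1, 1, -10, -20⟩ : WeierstrassCurve ℚ) := rfl

/-- The integer model of `11a1` is Cremona's. [cite: SilvermanAEC2009, VIII.8] -/
theorem intModel_11A1 :
    haveI := isGloballyMinimal_curve11A1
    integralModelInt curve11A1 = (⟨0, -1, 1, -10, -20⟩ : WeierstrassCurve ℤ) :=
  haveI := isGloballyMinimal_curve11A1
  integralModelInt_eq_of_map_eq _ (by rw [curve11A1_eq]; ext <;> simp [WeierstrassCurve.map])

/-- The integer model base-changed to `ℚ` is `curve11A1`. [folklore] -/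
theorem baseChange_int_11A1 : (⟨0, -1, 1, -10, -20⟩ : WeierstrassCurve ℤ).baseChange ℚ = curve11A1 := by
  rw [curve11A1_eq]; ext <;> simp [WeierstrassCurve.baseChange, WeierstrassCurve.map]

/-- `b₂, b₄, b₆` of `11a1`. [cite: SilvermanAEC2009, III.1] -/
theorem b_11A1 : curve11A1.b₂ = ((-4 : ℤ) : ℚ) ∧ curve11A1.b₄ = ((-20 : ℤ) : ℚ) ∧ curve11A1.b₆ = ((-79 : ℤ) : ℚ) := by
  rw [curve11A1_eq]; simp only [WeierstrassCurve.b₂, WeierstrassCurve.b₄, WeierstrassCurve.b₆]; norm_num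

/-- **`E[2]` irreducible for `11a1`** (`E(ℚ)[2] = 0`; Cremona: `E(ℚ) ≅ ℤ/5`): the monic `2`-division cubic `X³ − 4X² − 160X − 1264` has no root modulo `3`.
[cite: SilvermanAEC2009, III.2.3 (b)] [cite: KrizLi2019, Thm. 5.1 (hypothesis E(ℚ)[2] = 0) and §6 Example 6.5] -/
theorem irr_two_11A1 : Irr curve11A1 2 :=
  irr_two_of_forall_cubic_ne _ b_11A1.1 b_11A1.2.1 b_11A1.2.2 (ℓ := 3) (by decide)

/-- **`E(ℚ)[2] = 0` for `11a1`** in Kriz–Li's shape. [cite: KrizLi2019, Thm. 5.1 hypothesis "E(ℚ)[2] = 0"] -/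
theorem twoTorsion_11A1 : ∀ Q : curve11A1.toAffine.Point, 2 • Q = 0 → Q = 0 :=
  (X5.O1.irr_two_iff_forall_two_nsmul _).mp irr_two_11A1

/-- **`11a1` has GOOD reduction at `2`** (`2 ≠ 11`; tree `BurungaleSkinner2023.hasGoodReductionAtPrime_curve11A1`).
[cite: SilvermanAEC2009, VII.5 Prop. 5.1 (a)] [cite: KrizLi2019, §6 Table 2 (row 11a1: c₂ = 1)] -/
theorem hasGoodReductionAtPrime_two_11A1 :
    haveI : Fact (Nat.Prime 2) := ⟨Nat.prime_two⟩
    curve11A1.HasGoodReductionAtPrime 2 :=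
  haveI : Fact (Nat.Prime 2) := ⟨Nat.prime_two⟩
  hasGoodReductionAtPrime_curve11A1 (by norm_num)

/-- **`c₂(11a1) = 1`** (good reduction: Tate's Step 1). [cite: SilvermanAEC2009, VII.2 remark after Prop. 2.1] [cite: KrizLi2019, §6 Table 2 (row 11a1: c₂ = 1)] -/
theorem localTamagawaNumber_two_11A1 :
    haveI : Fact (Nat.Prime 2) := ⟨Nat.prime_two⟩
    (curve11A1.baseChange ℚ_[2]).localTamagawaNumber ℤ_[2] = 1 :=
  haveI := isGloballyMinimal_curve11A1
  haveI : Fact (Nat.Prime 2) := ⟨Nat.prime_two⟩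
  localTamagawaNumber_padic_eq_one_of_good_holds _ 2 hasGoodReductionAtPrime_two_11A1

/-- **`c₂(11a1)` is ODD** (`= 1`). [cite: KrizLi2019, Thm. 5.1 (hypothesis "c₂(E) odd") and §6 Table 2 (row 11a1)] -/
theorem odd_localTamagawaNumber_two_11A1 :
    haveI : Fact (Nat.Prime 2) := ⟨Nat.prime_two⟩
    Odd ((curve11A1.baseChange ℚ_[2]).localTamagawaNumber ℤ_[2]) := by
  rw [localTamagawaNumber_two_11A1]; exact odd_one

/-- **`11a1` is non-CM**: multiplicative at `11` (tree `hasMultiplicativeReductionAtPrime_curve11A1`), so `ord₁₁ j < 0` (`j = −2¹²·31³/11⁵`).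
[cite: SilvermanAEC2009, App. C §11] -/
theorem not_hasCM_11A1 : ¬ curve11A1.HasCM := by
  haveI := isGloballyMinimal_curve11A1
  haveI : Fact (Nat.Prime 11) := ⟨by norm_num⟩
  exact AdditivePotMult.not_hasCM_of_padicValRat_j_neg (p := 11) (EisensteinPrimes.padicValRat_j_neg_of_mult _ 11
    hasMultiplicativeReductionAtPrime_curve11A1)

/-- **`N(11a1) < 5000`** (Creutz–Miller's range; `N = 11` is the tree's `Curve11a.conductorNorm_curve11A1`). [cite: CreutzMiller2012, Thm. 1.1] -/
theorem conductorNorm_lt_5000_11A1 : curve11A1.conductorNorm ℤ < 5000 := by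
  rw [Curve11a.conductorNorm_curve11A1]; norm_num

/-- **`ord_{s=1} L(11a1, s) = 0` modulo the Modularity Theorem alone** (tree `Curve11a.analyticRank_eq_zero_of_modularity`: `w(11a) = +1` by the split
place at `11` and Atkin–Lehner, then the kernel certificate `L(E,1) = 2∑(aₙ/n)e^{−2πn/√11} > 0`) — the «rank zero» caption of Kriz–Li's Table 2 as a theorem.
[cite: CremonaAlgorithms1997, Appendix to Ch. II, Example 1 (N = 11) and Table 1 (11A1: r = 0)] [cite: KrizLi2019, §6 Example 6.5 ("rank zero optimal elliptic curves")] -/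
theorem analyticRank_11A1 (hmod : exists_isNewformOf) : curve11A1.analyticRank = 0 :=
  Curve11a.analyticRank_eq_zero_of_modularity hmod

end Base11A1

/-! ## §2 The partner `T′ = 11a1^{(−7)} = [0,7,1,−490,6774]`: global minimal, `Δ = −7⁶·11⁵`, `N(T′) = 7²·11 = 539 < 5000` -/
section Partner11A1

/-- **The tree's quadratic twist `11a1^{(−7)}` IS `[0,7,0,−490,27097/4]`** (`(b₂, b₄, b₆) = (−4, −20, −79)`). [cite: SilvermanAEC2009, X.5 Cor. 5.4] -/
theorem quadraticTwist_neg7_11A1 :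
    curve11A1.quadraticTwist (-7) = (⟨0, 7, 0, -490, 27097 / 4⟩ : WeierstrassCurve ℚ) := by
  rw [curve11A1_eq]
  ext <;> norm_num [WeierstrassCurve.quadraticTwist, WeierstrassCurve.b₂, WeierstrassCurve.b₄, WeierstrassCurve.b₆]

/-- **`(1, 0, 0, ½) • 11a1^{(−7)} = [0,7,1,−490,6774]`** — an integral minimal model of the companion (complete the square back: `y ↦ y + ½`).
[cite: SilvermanAEC2009, III.1 Table 3.1 and X.5 Cor. 5.4] -/
theorem smul_quadraticTwist_neg7_11A1 :
    (⟨1, 0, 0, (1 : ℚ) / 2⟩ : VariableChange ℚ) • curve11A1.quadraticTwist (-7) = (⟨0, 7, 1, -490, 6774⟩ : WeierstrassCurve ℚ) := by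
  rw [quadraticTwist_neg7_11A1]
  ext <;> norm_num [variableChange_a₁, variableChange_a₂, variableChange_a₃, variableChange_a₄, variableChange_a₆]

/-- `T′ = [0,7,1,−490,6774]` is an elliptic curve (`Δ = −7⁶·11⁵ ≠ 0`). [cite: SilvermanAEC2009, III.1] -/
theorem isElliptic_T11A1 : (⟨0, 7, 1, -490, 6774⟩ : WeierstrassCurve ℚ).IsElliptic := ⟨by
  rw [isUnit_iff_ne_zero]; norm_num [WeierstrassCurve.Δ, WeierstrassCurve.b₂, WeierstrassCurve.b₄, WeierstrassCurve.b₆, WeierstrassCurve.b₈]⟩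

/-- `T′` is GLOBALLY MINIMAL (`|Δ| = 7⁶·11⁵`: `v_p Δ < 12` everywhere). [cite: SilvermanAEC2009, VII.1 Remark 1.1] [cite: Kraus1989, Prop. 1 and Prop. 2] -/
theorem isGloballyMinimal_T11A1 : (⟨0, 7, 1, -490, 6774⟩ : WeierstrassCurve ℚ).IsGloballyMinimal :=
  isGloballyMinimal_of_krausCriterion_support (0) (7) (1) (-490) (6774) [(7, 0, 6), (11, 0, 5)]
    (by intro t ht; simp only [List.mem_cons, List.not_mem_nil, or_false] at ht
        rcases ht with rfl | rfl <;> norm_num)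
    (by decide +kernel) (by decide +kernel)

/-- `Δ(T′) = −18947489099 = −7⁶·11⁵`. [cite: CremonaAlgorithms1997, Table 1 (conductor 539)] -/
theorem MT11A1_Δ : (⟨0, 7, 1, -490, 6774⟩ : WeierstrassCurve ℤ).Δ = -18947489099 := by decide +kernel
/-- `c₄(T′) = 24304 = 2⁴·7²·31`. [cite: CremonaAlgorithms1997, Table 1 (conductor 539)] -/
theorem MT11A1_c₄ : (⟨0, 7, 1, -490, 6774⟩ : WeierstrassCurve ℤ).c₄ = 24304 := by decide +kernel

/-- The integer model base-changed to `ℚ` is the rational model. [folklore] -/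
theorem baseChange_int_T11A1 :
    (⟨0, 7, 1, -490, 6774⟩ : WeierstrassCurve ℤ).baseChange ℚ = (⟨0, 7, 1, -490, 6774⟩ : WeierstrassCurve ℚ) := by
  ext <;> simp [WeierstrassCurve.baseChange, WeierstrassCurve.map]

/-- The integer model of `T′`. [cite: SilvermanAEC2009, VIII.8] -/
theorem intModel_T11A1 :
    haveI := isElliptic_T11A1; haveI := isGloballyMinimal_T11A1
    integralModelInt (⟨0, 7, 1, -490, 6774⟩ : WeierstrassCurve ℚ) = (⟨0, 7, 1, -490, 6774⟩ : WeierstrassCurve ℤ) :=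
  haveI := isElliptic_T11A1; haveI := isGloballyMinimal_T11A1
  integralModelInt_eq_of_map_eq _ (by ext <;> simp [WeierstrassCurve.map])

/-- **`N(T′) ∣ |Δ_min| = 18947489099`.** [cite: SilvermanAEC2009, VIII.11 and C.16] -/
theorem conductorNorm_dvd_T11A1 :
    haveI := isElliptic_T11A1
    (⟨0, 7, 1, -490, 6774⟩ : WeierstrassCurve ℚ).conductorNorm ℤ ∣ 18947489099 := by
  haveI := isElliptic_T11A1; haveI := isGloballyMinimal_T11A1
  have hdvd := WeierstrassCurve.conductorNorm_dvd_minimalDiscriminantNorm (⟨0, 7, 1, -490, 6774⟩ : WeierstrassCurve ℚ)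
    (WeierstrassCurve.finite_setOf_ordMinimalDiscriminant_ne_zero_holds _)
  rw [WeierstrassCurve.minimalDiscriminantNorm_int_eq_natAbs_minimalDiscriminantInt_holds,
    minimalDiscriminantInt_eq intModel_T11A1, MT11A1_Δ] at hdvd
  exact hdvd

/-- **Tate certificate for `T′` at `7`, kernel check** (Steps 1–6): translate by `(r,s,t) = (0,0,24)` to `[0,7,49,−490,6174]` (`7 ∣ a₂`, `7² ∣ a₃, a₄`,
`7³ ∣ a₆ = 18·343`); Step 6 exit: the cubic `T³ + T² − 10T + 18` has distinct roots mod `7` (discriminant `−7960 ≢ 0`) — type `I₀*`, `v₇(Δ) = 6`.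
[cite: Silverman1994, IV.9.4 Steps 1–6] -/
theorem tateDeepCheck_seven_T11A1 : DeepCert.check ⟨7, 0, 0, 24, 6, 6, 0⟩ ⟨0, 7, 1, -490, 6774⟩ = true := by
  decide +kernel

/-- **`f₇(T′) = 2`** (Ogg: `6 + 1 − 5` components of `I₀*`). [cite: Silverman1994, IV.11.1] -/
theorem conductorExponent_seven_T11A1 (v : HeightOneSpectrum ℤ) (hv : natGenerator v = 7) :
    (⟨0, 7, 1, -490, 6774⟩ : WeierstrassCurve ℚ).conductorExponent v = 2 := by
  have h := DeepCert.conductorExponent_int_eq (W₀ := ⟨0, 7, 1, -490, 6774⟩) (c := ⟨7, 0, 0, 24, 6, 6, 0⟩) v hv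
    (by rw [baseChange_int_T11A1]; exact isGloballyMinimal_T11A1) tateDeepCheck_seven_T11A1
  rw [baseChange_int_T11A1] at h
  exact h

/-- **`ord₇ N(T′) = 2`, `ord₁₁ N(T′) = 1`** (the latter: multiplicative at `11`, `11 ∣ Δ`, `11 ∤ c₄ = 24304`). [cite: Silverman1994, IV.11.1] -/
theorem factorization_conductorNorm_T11A1 :
    haveI := isElliptic_T11A1
    (((⟨0, 7, 1, -490, 6774⟩ : WeierstrassCurve ℚ).conductorNorm ℤ).factorization 7 = 2) ∧
      (((⟨0, 7, 1, -490, 6774⟩ : WeierstrassCurve ℚ).conductorNorm ℤ).factorization 11 = 1) := by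
  haveI := isElliptic_T11A1; haveI := isGloballyMinimal_T11A1
  haveI hE : ((⟨0, 7, 1, -490, 6774⟩ : WeierstrassCurve ℤ).baseChange ℚ).IsElliptic := by rw [baseChange_int_T11A1]; infer_instance
  have h7 : Nat.Prime 7 := by norm_num
  have h11 : Nat.Prime 11 := by norm_num
  refine ⟨?_, ?_⟩
  · rw [show (7 : ℕ) = ((⟨7, h7⟩ : Nat.Primes) : ℕ) from rfl, factorization_conductorNorm_primesEquiv_symm]
    exact conductorExponent_seven_T11A1 _ (congrArg Subtype.val ((primesEquiv (R := ℤ)).apply_symm_apply ⟨7, h7⟩))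
  · set v : HeightOneSpectrum ℤ := (primesEquiv (R := ℤ)).symm ⟨11, h11⟩ with hv
    have hgen : natGenerator v = 11 := congrArg Subtype.val ((primesEquiv (R := ℤ)).apply_symm_apply ⟨11, h11⟩)
    have hmin : ((⟨0, 7, 1, -490, 6774⟩ : WeierstrassCurve ℤ).baseChange ℚ).IsMinimalAt v := by
      rw [baseChange_int_T11A1]; exact IsGloballyMinimal.isMinimalAt_int _ v
    have h1 : ((⟨0, 7, 1, -490, 6774⟩ : WeierstrassCurve ℤ).baseChange ℚ).conductorExponent v = 1 :=
      conductorExponent_eq_one_of_dvd_Δ_of_not_dvd_c₄ hmin (by rw [hgen, MT11A1_Δ]; decide) (by rw [hgen, MT11A1_c₄]; decide)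
    rw [baseChange_int_T11A1] at h1
    rw [show (11 : ℕ) = ((⟨11, h11⟩ : Nat.Primes) : ℕ) from rfl, factorization_conductorNorm_primesEquiv_symm]
    exact h1

/-- The prime factorisation of `7ᵃ·11ᵇ`, read coefficientwise. [folklore] -/
theorem factorization_seven_pow_mul_eleven_pow (a b q : ℕ) :
    (7 ^ a * 11 ^ b).factorization q = if q = 7 then a else if q = 11 then b else 0 := by
  have h7 : Nat.Prime 7 := by norm_num
  have h11 : Nat.Prime 11 := by norm_num
  rw [Nat.factorization_mul (pow_ne_zero _ h7.ne_zero) (pow_ne_zero _ h11.ne_zero), Finsupp.add_apply,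
    Nat.factorization_pow, Nat.factorization_pow, Finsupp.smul_apply, Finsupp.smul_apply, h7.factorization, h11.factorization,
    Finsupp.single_apply, Finsupp.single_apply]
  by_cases hq7 : q = 7
  · subst hq7; simp
  by_cases hq11 : q = 11
  · subst hq11; simp
  · simp [Ne.symm hq7, Ne.symm hq11, hq7, hq11]

/-- **`N(T′) = 539 = 7²·11` IN THE KERNEL** (`N ∣ 7⁶·11⁵`, `ord₇ N = 2`, `ord₁₁ N = 1`). [cite: CremonaAlgorithms1997, Table 1 (conductor 539)] -/
theorem conductorNorm_T11A1 :
    haveI := isElliptic_T11A1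
    (⟨0, 7, 1, -490, 6774⟩ : WeierstrassCurve ℚ).conductorNorm ℤ = 539 := by
  haveI := isElliptic_T11A1
  set N := (⟨0, 7, 1, -490, 6774⟩ : WeierstrassCurve ℚ).conductorNorm ℤ with hN
  have hN0 : N ≠ 0 := (conductorNorm_pos_holds _).ne'
  obtain ⟨h7, h11⟩ := factorization_conductorNorm_T11A1
  have hle := (Nat.factorization_le_iff_dvd hN0 (by norm_num : (18947489099 : ℕ) ≠ 0)).mpr conductorNorm_dvd_T11A1
  have e539 : (539 : ℕ) = 7 ^ 2 * 11 ^ 1 := by norm_num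
  have eΔ : (18947489099 : ℕ) = 7 ^ 6 * 11 ^ 5 := by norm_num
  refine Nat.eq_of_factorization_eq hN0 (by norm_num) fun q => ?_
  rw [e539, factorization_seven_pow_mul_eleven_pow]
  by_cases hq7 : q = 7
  · subst hq7; rw [h7]; simp
  by_cases hq11 : q = 11
  · subst hq11; rw [h11]; simp
  have hq' := hle q
  rw [eΔ, factorization_seven_pow_mul_eleven_pow, if_neg hq7, if_neg hq11] at hq'
  rw [if_neg hq7, if_neg hq11]
  exact Nat.le_zero.mp hq'

/-- **`N(T′) < 5000`** (Creutz–Miller's range). [cite: CreutzMiller2012, Thm. 1.1] -/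
theorem conductorNorm_lt_5000_T11A1 :
    haveI := isElliptic_T11A1
    (⟨0, 7, 1, -490, 6774⟩ : WeierstrassCurve ℚ).conductorNorm ℤ < 5000 := by
  rw [conductorNorm_T11A1]; norm_num

end Partner11A1

/-! ## §3 The packet witness `ℓ = 23`: `#Ẽ(𝔽₂₃) = 25` (`a₂₃ = −1` odd) -/
section Witness11A1

/-- **`#Ẽ(𝔽₂₃) = 25` for `11a1`** (certified count; `23 ∤ Δ = −11⁵`), so `a₂₃ = 24 − 25 = −1`. [cite: SilvermanAEC2009, V.2] -/
theorem reductionPointCount_23_11A1 :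
    haveI := isGloballyMinimal_curve11A1
    curve11A1.reductionPointCount 23 = 25 := by
  haveI : Fact (Nat.Prime 23) := ⟨by norm_num⟩
  haveI := isGloballyMinimal_curve11A1
  exact Supersingular.reductionPointCount_eq_of_intModel_countPoints intModel_11A1 23 (by norm_num) (by decide +kernel)
    (by decide +kernel)

/-- **`a₂₃(11a1)` is odd** (`= −1`: `Frob₂₃` has order `3` on `E[2]`). [cite: KrizLi2019, Def. 4.1 ("Frob_ℓ of order 3")] -/
theorem odd_frobeniusTrace_23_11A1 :
    haveI := isGloballyMinimal_curve11A1
    Odd (curve11A1.frobeniusTrace 23) := by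
  haveI := isGloballyMinimal_curve11A1
  rw [Uniform.U2.odd_frobeniusTrace_iff_odd_reductionPointCount _ (by norm_num : Nat.Prime 23) (by norm_num),
    reductionPointCount_23_11A1]
  decide

end Witness11A1

end Summit.BirchSwinnertonDyer.BirchSwinnertonDyer.Theorems.GenusExact.TwinSwap.KrizLiAnchor11a1

end
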